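import Literature.AlgebraicGeometry.HodgeTheory.ArapuraSurfaceFibredFourfoldsSplitAssembly
import Literature.AlgebraicTopology.SingularHomology.FiniteCoverTransfer
import Literature.AlgebraicGeometry.Motives.ComplexPointsFiniteEtaleCovering
import Literature.AlgebraicGeometry.Motives.JacobianHomology
import Literature.AlgebraicGeometry.HodgeTheory.AlgebraicCyclesDefinedOverQbarSpread
import HarnessLib

/-!
# Arapura (2022), Cor. 1.5 on the smooth part: reduction to relative divisor classes after a finite étale base change

Topic `Literature/AlgebraicGeometry/HodgeTheory`, fourth proof file of the named fact
`Arapura2022_thm_1_2_smoothPart_pgZeroSurfaceFibration` (`ArapuraSurfaceFibredFourfoldsSplit.lean`;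
D. Arapura, *Hodge cycles and the Leray filtration*, Pacific J. Math. **319** (2022), Cor. 1.5
with Thm. 1.2 and Cor. 1.4). `ArapuraSurfaceFibredFourfoldsSplitAssembly.lean` reduced the fact to
the hypothesis `hBC` (`…_of_baseChange''`): a smooth projective fourfold `X' → X` of NON-ZERO
DEGREE containing a smooth proper surface family as a dense open subscheme, with divisor classes
spanning `H²` of one fibre — i.e. the finite base change of the printed proof TOGETHER WITH a
smooth projective compactification mapping to `X` and its degree. This file removes the
compactification and the degree: following C. Voisin's rendering of the same argument (*Hodge
Theory II*, proof of Prop. 11.15, p. 303: the parameter curve `D → ℙ¹` of the divisors, the cycle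
`𝒟 ⊂ D ×_{ℙ¹} 𝒳` and the local systems `R⁰r_*ℤ → R²f_*ℤ` over `U`, WITHOUT compactifying the
base-changed family), the vanishing of every class of `H⁴(X(ℂ); ℂ)` on a Zariski-open set is
obtained on `X` ITSELF by descending, along the finite étale base change, the vanishing proved
upstairs — the descent being the injectivity of `p^*` for finite coverings in rational cohomology
(transfer; Hatcher Prop. 3G.1, the tree's `IsFiniteCover.singularCohomology_map_injective`).

Main results (everything here is PROVED; no definition, no named fact — D-0026):

* `singularCohomology_map_eq_zero_of_finiteCover_of_isOpenEmbedding` — **descent of vanishing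
  along a finite covering onto an open subset** (topology): for a finite covering `e₀ : E → W`, an
  open embedding `ι : W → X`, `Ω ⊆ ι(W)` and a class `c ∈ Hⁿ(X; R)` (`R` a `ℚ`-algebra) whose
  pull-back `(ι ∘ e₀)^* c` vanishes on `(ι ∘ e₀)⁻¹(Ω)`, `c|_Ω = 0`.
* `coheight_apply_eq_of_locallyQuasiFinite` — a flat, locally quasi-finite morphism of locally
  Noetherian schemes (e.g. étale) preserves the codimension of points (Hartshorne III Prop. 9.5
  with zero-dimensional fibres).
* `supportedClasses_eq_top_of_finiteEtale_surfaceFamily` — **`N¹H⁴(X(ℂ); ℂ) = H⁴(X(ℂ); ℂ)` for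
  a smooth projective fourfold `X` receiving, onto an open subscheme `W ↪ X`, a finite étale
  surjection `V' → W` from the total space of a smooth proper family `π' : V' → U'` of smooth
  projective surfaces over a smooth affine connected surface whose fibres embed into `X`, carrying
  classes `ζ_i ∈ N¹H²(V'(ℂ); ℂ)` (supported on divisors) that span `H²` of one fibre.** Proof:
  `H⁴(V'(ℂ)) = η ∪ H² + Σ_i ζ_i ∪ H²` (`exists_eq_cupProduct_add_sum_of_smooth_proper_family`,
  `η` the pull-back of the hyperplane class, hard Lefschetz on the fibres through their embedding
  in `X ⊆ ℙᴹ`), so the pull-back of any `c ∈ H⁴(X(ℂ))` dies on the complement of the supports;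
  these supports and the hyperplane map to a proper Zariski-closed `Z ⊊ X` (finite morphisms are
  closed, étale ones preserve codimension); transfer.
* `Arapura2022_thm_1_2_smoothPart_pgZeroSurfaceFibration_of_relativeDivisorClasses` — **the named
  fact from the hypothesis `hRD`**: for every `f : X ⟶ Y` as in Cor. 1.5, such a finite étale
  `V' → W ⊆ X` with a surface-family structure and divisor-supported classes spanning `H²` of one
  fibre exists. This is exactly "after a finite base change, `[𝒵_1], …, [𝒵_N]` gives a basis of
  `R²f_*ℚ`" (p. 5: components `T_i` of the relative Hilbert scheme `Hilb_{X/Y}` through divisors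
  `Z_i ⊂ X_y` spanning `H²(X_y, ℚ)` — Lefschetz `(1,1)` and `p_g = 0` —, made generically finite,
  their universal families `𝒵_i`, and the finite base change dominating the `T_i`, restricted to
  the étale locus `U' → U`, `V' = X ×_Y U'`), with NO compactification of `V'` and NO degree;
  the rest of the printed proof is discharged by theorems of the tree (`h3`, `hD`, `hV`, the
  topological half, and the present descent).

## References

* D. Arapura, *Hodge cycles and the Leray filtration*, Pacific J. Math. 319 (2022) 233–258
  (arXiv:2103.05038), Thm. 1.2, Cor. 1.4, Cor. 1.5 and its proof (p. 5). [Arapura2022]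
* C. Voisin, *Hodge Theory and Complex Algebraic Geometry II*, CUP (2003), §11.2.1, proof of
  Prop. 11.15 (p. 303): relative Hilbert schemes, `𝒟 ⊂ D ×_{ℙ¹} 𝒳`, `α : R⁰r_*ℤ → R²f_*ℤ^G`.
  [VoisinHodgeII2003]
* A. Hatcher, *Algebraic Topology*, CUP (2002), §3.G p. 321 and Prop. 3G.1 (transfer).
  [HatcherAT2002]
* R. Hartshorne, *Algebraic Geometry*, GTM 52 (1977), III Prop. 9.5, II Ex. 3.20. [Hartshorne1977]
* A. Grothendieck, M. Raynaud, *SGA 1*, Exp. XII Prop. 3.1, Thm. 5.1 (easy direction). [SGA1]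
-/

noncomputable section

open Set Function CategoryTheory AlgebraicGeometry Topology
open Literature.AlgebraicTopology.SingularHomology Literature.Geometry.Kaehler

namespace Literature.AlgebraicGeometry.HodgeTheory

section HodgeTheory

universe u

/-! ### Descent of vanishing along a finite covering onto an open subset -/

/-- **Restriction of a finite covering over a subset of the base is a finite covering**: for
`S ⊆ B`, `p : p⁻¹(S) → S` is again a covering map (Mathlib `IsCoveringMap.restrictPreimage`)
with finite non-empty fibres. [cite: HatcherAT2002, §1.3] -/
theorem isFiniteCover_restrictPreimage {E B : Type u} [TopologicalSpace E] [TopologicalSpace B]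
    {p : C(E, B)} (c : IsFiniteCover p) (S : Set B) :
    IsFiniteCover (⟨S.restrictPreimage p, c.isCoveringMap.continuous.restrictPreimage⟩ :
      C(p ⁻¹' S, S)) := by
  refine ⟨c.isCoveringMap.restrictPreimage S, S.restrictPreimage_surjective c.surjective, ?_⟩
  intro x
  have hset : ((⟨S.restrictPreimage p, c.isCoveringMap.continuous.restrictPreimage⟩ :
      C(p ⁻¹' S, S)) ⁻¹' {x} : Set (p ⁻¹' S)) = Subtype.val ⁻¹' (p ⁻¹' {x.1}) := by
    ext e
    simp only [Set.mem_preimage, Set.mem_singleton_iff, ContinuousMap.coe_mk]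
    constructor
    · intro h
      exact congrArg Subtype.val h
    · intro h
      exact Subtype.ext h
  rw [hset]
  exact (c.finite_fibre x.1).preimage Subtype.val_injective.injOn

/-- **Descent of vanishing along a finite covering onto an open subset.** Let `e₀ : E → W` be a
finite covering (covering map, finite non-empty fibres), `ι : W → X` an open embedding,
`Ω ⊆ ι(W)`, and `c ∈ Hⁿ(X; R)`, `R` a commutative `ℚ`-algebra. If the pull-back `(ι ∘ e₀)^* c`
vanishes on `(ι ∘ e₀)⁻¹(Ω) ⊆ E`, then `c` vanishes on `Ω`: `ι` restricts to a homeomorphism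
`ι⁻¹(Ω) ≃ Ω`, `e₀` to a finite covering `(ι ∘ e₀)⁻¹(Ω) → ι⁻¹(Ω)`, and `p^*` is injective for finite
coverings (transfer, Hatcher Prop. 3G.1). [cite: HatcherAT2002, §3.G Prop. 3G.1] -/
theorem singularCohomology_map_eq_zero_of_finiteCover_of_isOpenEmbedding
    {E W X : Type} [TopologicalSpace E] [TopologicalSpace W] [TopologicalSpace X]
    {e₀ : C(E, W)} (he₀ : IsFiniteCover e₀) {ι : C(W, X)} (hι : IsOpenEmbedding ι)
    {Ω : Set X} (hΩ : Ω ⊆ Set.range ι) (R : Type) [CommRing R] [Algebra ℚ R] (n : ℕ)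
    (c : singularCohomology R R X n)
    (hc : singularCohomology.map R R (⟨Subtype.val, continuous_subtype_val⟩ :
        C(↥((ι.comp e₀) ⁻¹' Ω), E)) n (singularCohomology.map R R (ι.comp e₀) n c) = 0) :
    singularCohomology.map R R (⟨Subtype.val, continuous_subtype_val⟩ : C(↥Ω, X)) n c = 0 := by
  -- the finite covering `q : e₀⁻¹(ι⁻¹ Ω) → ι⁻¹ Ω`
  set S : Set W := ι ⁻¹' Ω with hS
  have hq : IsFiniteCover (⟨S.restrictPreimage e₀, he₀.isCoveringMap.continuous.restrictPreimage⟩ :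
      C(e₀ ⁻¹' S, S)) := isFiniteCover_restrictPreimage he₀ S
  -- the homeomorphism `φ : ι⁻¹(Ω) ≃ₜ Ω`
  set φ : ↥S ≃ₜ ↥Ω := hι.toIsEmbedding.homeomorphOfSubsetRange hΩ with hφ
  -- `(ι ∘ e₀)⁻¹ Ω = e₀⁻¹ S`
  have hpre : (ι.comp e₀) ⁻¹' Ω = e₀ ⁻¹' S := by
    rw [hS, ← Set.preimage_comp]; rfl
  -- `φ^*(c|_Ω) = (ι^* c)|_S`
  have hmaps : (⟨Subtype.val, continuous_subtype_val⟩ : C(↥Ω, X)).comp (φ : C(↥S, ↥Ω)) =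
      ι.comp (⟨Subtype.val, continuous_subtype_val⟩ : C(↥S, W)) :=
    ContinuousMap.ext fun x => Topology.IsEmbedding.homeomorphOfSubsetRange_apply_coe hι.toIsEmbedding hΩ x
  have h1 : singularCohomology.map R R (φ : C(↥S, ↥Ω)) n
      (singularCohomology.map R R (⟨Subtype.val, continuous_subtype_val⟩ : C(↥Ω, X)) n c) =
      singularCohomology.map R R (⟨Subtype.val, continuous_subtype_val⟩ : C(↥S, W)) n
        (singularCohomology.map R R ι n c) := by
    rw [← ModuleCat.comp_apply, ← singularCohomology.map_comp, ← ModuleCat.comp_apply,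
      ← singularCohomology.map_comp, hmaps]
  -- `q^*((ι^* c)|_S) = ((ι ∘ e₀)^* c)|_{(ι ∘ e₀)⁻¹ Ω} = 0`
  have h2 : singularCohomology.map R R
      (⟨S.restrictPreimage e₀, he₀.isCoveringMap.continuous.restrictPreimage⟩ : C(e₀ ⁻¹' S, S)) n
      (singularCohomology.map R R (⟨Subtype.val, continuous_subtype_val⟩ : C(↥S, W)) n
        (singularCohomology.map R R ι n c)) = 0 := by
    have hcomp : ((⟨Subtype.val, continuous_subtype_val⟩ : C(↥S, W)).comp
        (⟨S.restrictPreimage e₀, he₀.isCoveringMap.continuous.restrictPreimage⟩ :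
          C(e₀ ⁻¹' S, S))) =
        e₀.comp (⟨Subtype.val, continuous_subtype_val⟩ : C(↥(e₀ ⁻¹' S), E)) := rfl
    rw [← ModuleCat.comp_apply, ← singularCohomology.map_comp, hcomp, singularCohomology.map_comp,
      ModuleCat.comp_apply, ← ModuleCat.comp_apply (singularCohomology.map R R ι n),
      ← singularCohomology.map_comp]
    -- transport `hc` along `hpre`
    have key : ∀ (T : Set E) (hT : T = e₀ ⁻¹' S),
        singularCohomology.map R R (⟨Subtype.val, continuous_subtype_val⟩ : C(↥T, E)) n
          (singularCohomology.map R R (ι.comp e₀) n c) = 0 →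
        singularCohomology.map R R (⟨Subtype.val, continuous_subtype_val⟩ : C(↥(e₀ ⁻¹' S), E)) n
          (singularCohomology.map R R (ι.comp e₀) n c) = 0 := by
      rintro T rfl h; exact h
    exact key _ hpre hc
  have h3 : singularCohomology.map R R (⟨Subtype.val, continuous_subtype_val⟩ : C(↥S, W)) n
      (singularCohomology.map R R ι n c) = 0 := hq.eq_zero_of_map_eq_zero n h2
  rw [← h1] at h3
  -- `φ^*` is injective
  have h4 := congrArg (singularCohomology.map R R (φ.symm : C(↥Ω, ↥S)) n) h3
  rw [map_zero, ← ModuleCat.comp_apply, ← singularCohomology.map_comp] at h4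
  have hid : (φ : C(↥S, ↥Ω)).comp (φ.symm : C(↥Ω, ↥S)) = ContinuousMap.id _ := by
    ext x; exact congrArg Subtype.val (φ.apply_symm_apply x)
  rwa [hid, singularCohomology.map_id, ModuleCat.id_apply] at h4

/-! ### Codimension is preserved by flat locally quasi-finite morphisms -/

/-- **A flat, locally quasi-finite morphism of locally Noetherian schemes preserves the
codimension of points**: `codim e(z) = codim z` (the flat dimension formula, Hartshorne III
Prop. 9.5, the tree's `coheight_eq_coheight_apply_of_forall_specializes`, the fibres being
discrete — Mathlib `Scheme.Hom.isDiscrete_preimage_singleton` — so that no point of a fibre is a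
proper generization of another). Applies to étale, in particular finite étale, morphisms and to
open immersions. [cite: Hartshorne1977, III Prop. 9.5] -/
theorem coheight_apply_eq_of_locallyQuasiFinite {P Q : Scheme} (e : P ⟶ Q) [Flat e]
    [LocallyQuasiFinite e] [IsLocallyNoetherian P] [IsLocallyNoetherian Q] (z : P) :
    Order.coheight (e.base z) = Order.coheight z := by
  symm
  refine coheight_eq_coheight_apply_of_forall_specializes e z fun y hy hyz ↦ ?_
  have hdisc := e.isDiscrete_preimage_singleton (e.base z)
  haveI : DiscreteTopology ↥(e.base ⁻¹' {e.base z}) := hdisc.to_subtype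
  have hy' : y ∈ e.base ⁻¹' {e.base z} := hy
  have hz' : z ∈ e.base ⁻¹' {e.base z} := rfl
  have hspec : (⟨y, hy'⟩ : ↥(e.base ⁻¹' {e.base z})) ⤳ ⟨z, hz'⟩ :=
    (subtype_specializes_iff _ _).2 hyz
  have heq := (specializes_iff_eq.1 hspec)
  exact congrArg Subtype.val heq

/-! ### `N¹H⁴ = H⁴` from a finite étale surface-family structure with divisor classes -/

/-- The closed set `(range ι)ᶜ ∪ ι(C)` attached to an open embedding `ι` and a closed `C`: its
complement `ι(W ∖ C)` is open. [folklore] -/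
theorem isClosed_compl_range_union_image {W X : Type*} [TopologicalSpace W] [TopologicalSpace X]
    {ι : W → X} (hι : IsOpenEmbedding ι) {C : Set W} (hC : IsClosed C) :
    IsClosed ((Set.range ι)ᶜ ∪ ι '' C) := by
  have h : ((Set.range ι)ᶜ ∪ ι '' C)ᶜ = ι '' Cᶜ := by
    ext x
    constructor
    · intro hx
      rw [Set.mem_compl_iff, Set.mem_union, not_or, Set.mem_compl_iff, not_not] at hx
      obtain ⟨⟨w, rfl⟩, h2⟩ := hx
      exact ⟨w, fun hw ↦ h2 ⟨w, hw, rfl⟩, rfl⟩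
    · rintro ⟨w, hw, rfl⟩
      rw [Set.mem_compl_iff, Set.mem_union, not_or, Set.mem_compl_iff, not_not]
      refine ⟨⟨w, rfl⟩, ?_⟩
      rintro ⟨w', hw', h'⟩
      exact hw (hι.injective h' ▸ hw')
  rw [← isOpen_compl_iff, h]
  exact hι.isOpenMap _ hC.isOpen_compl

variable {X : Motives.SchemeOver ℂ}

/-- **`N¹H⁴(X(ℂ); ℂ) = H⁴(X(ℂ); ℂ)` from a finite étale surface-family structure with divisor
classes** (the coniveau form of Arapura's proof of Cor. 1.5, the finite base change NOT
compactified). Data: a smooth projective fourfold `X`; an open immersion `ι : W ⟶ X`; a finite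
étale surjection `e₀ : V' ⟶ W`; a smooth proper morphism `π' : V' ⟶ U'` onto a smooth affine
connected surface all of whose fibres are smooth projective surfaces embedded into `X` by
`e₀ ≫ ι`; classes `ζ_i ∈ N¹H²(V'(ℂ); ℂ)` (supported in codimension `≥ 1`, e.g. classes of relative
divisors) whose restrictions span `H²` of ONE fibre. Then every class of `H⁴(X(ℂ); ℂ)` dies on a
non-empty Zariski-open subset of `X`. Proof: with `η = (e₀ ≫ ι)^* h` the pull-back of the
hyperplane class of `X ⊆ ℙᴹ` (hard Lefschetz on each fibre, a closed subvariety of `ℙᴹ`),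
`exists_eq_cupProduct_add_sum_of_smooth_proper_family` writes `(e₀ ≫ ι)^* c = η ∪ w + Σ ζ_i ∪ u_i`,
which dies off `(e₀ ≫ ι)⁻¹ H ∪ ⋃ supp ζ_i`; the Zariski-closed
`Z = H ∪ (X ∖ ι(W)) ∪ ι(e₀(⋃ supp ζ_i))` is proper (finite morphisms are closed; étale morphisms and
open immersions preserve codimension, `coheight_apply_eq_of_locallyQuasiFinite`), and `c` dies on
`(X ∖ Z)(ℂ)` by descent along the finite covering `(e₀ ≫ ι)(ℂ)` over it
(`singularCohomology_map_eq_zero_of_finiteCover_of_isOpenEmbedding`; `e₀(ℂ)` is a finite covering by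
SGA1 XII 3.1 / the tree's `ComplexPoints.isCoveringMap_map_of_isFinite`, onto by the
Nullstellensatz). [cite: Arapura2022, proof of Cor. 1.5 (p. 5) with Thm. 1.2 (proof, first reflection)]
[cite: VoisinHodgeII2003, §11.2.1, proof of Prop. 11.15 (p. 303)] [cite: HatcherAT2002, §3.G Prop. 3G.1]
[cite: SGA1, Exp. XII Prop. 3.1] -/
theorem supportedClasses_eq_top_of_finiteEtale_surfaceFamily (hX : Motives.IsSmoothProjective 4 X)
    {W V' U' : Motives.SchemeOver ℂ} (ι : W ⟶ X) [IsOpenImmersion ι.left]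
    (e₀ : V' ⟶ W) [IsFinite e₀.left] [Etale e₀.left] [AlgebraicGeometry.Surjective e₀.left]
    (π' : V' ⟶ U') [IsAffine U'.left] [ConnectedSpace U'.left] [SmoothOfRelativeDimension 2 U'.hom]
    [Smooth π'.left] [IsProper π'.left]
    (hfib : ∀ s : Motives.ComplexPoints U', Motives.IsSmoothProjective 2 (Motives.fiberOver π' s))
    (hemb : ∀ s : Motives.ComplexPoints U', IsClosedImmersion (Motives.fiberι π' s ≫ e₀ ≫ ι).left)
    {N : ℕ} (ζ : Fin N → complexBetti V' (2 * 1)) (hζ : ∀ i, ζ i ∈ algebraicClasses V' 1)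
    (s₀ : Motives.ComplexPoints U')
    (hspan : Submodule.span ℂ (Set.range fun i : Fin N => singularCohomology.map ℂ ℂ
      (Motives.AlgPoints.mapContinuous (L := ℂ) (Motives.fiberι π' s₀)) 2 (ζ i)) = ⊤) :
    supportedClasses X (2 * 2) 1 = ⊤ := by
  classical
  /- instances -/
  haveI := hX.smoothOfRelativeDimension
  haveI : IsSeparated U'.hom := inferInstance
  haveI : IsSeparated V'.hom := by rw [← Over.w π']; infer_instance
  haveI : SmoothOfRelativeDimension 4 W.hom := by
    rw [← Over.w ι]; exact inferInstanceAs (SmoothOfRelativeDimension (0 + 4) (ι.left ≫ X.hom))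
  haveI : SmoothOfRelativeDimension 4 V'.hom := by
    rw [← Over.w e₀]; exact inferInstanceAs (SmoothOfRelativeDimension (0 + 4) (e₀.left ≫ W.hom))
  haveI : Smooth W.hom := SmoothOfRelativeDimension.smooth (n := 4) (f := W.hom)
  haveI : Smooth V'.hom := SmoothOfRelativeDimension.smooth (n := 4) (f := V'.hom)
  haveI : Smooth X.hom := SmoothOfRelativeDimension.smooth (n := 4) (f := X.hom)
  haveI : LocallyOfFiniteType W.hom := inferInstance
  haveI : LocallyOfFiniteType V'.hom := inferInstance
  haveI : LocallyOfFiniteType X.hom := inferInstance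
  haveI : IsLocallyNoetherian W.left := LocallyOfFiniteType.isLocallyNoetherian W.hom
  haveI : IsLocallyNoetherian V'.left := LocallyOfFiniteType.isLocallyNoetherian V'.hom
  haveI : IsLocallyNoetherian X.left := LocallyOfFiniteType.isLocallyNoetherian X.hom
  haveI := irreducibleSpace_of_isSmoothProjective' hX
  /- (1) `e₀(ℂ)` is a finite covering -/
  obtain ⟨hcov, hfinfib⟩ := Motives.ComplexPoints.isCoveringMap_map_of_isFinite 4 e₀
  have he₀C : IsFiniteCover (Motives.AlgPoints.mapContinuous (L := ℂ) e₀) :=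
    ⟨hcov, Motives.AlgPoints.map_surjective_of_surjective e₀, hfinfib⟩
  /- (2) the hyperplane class `h` of `X` and `η = g^* h`, `g = e₀ ≫ ι` -/
  obtain ⟨r₀, hr₀⟩ :=
    exists_forall_hasHardLefschetzProperty_map hX.isProjectiveOver.projectiveEmbedding.n
  set κ := hX.isProjectiveOver.projectiveEmbedding.ι with hκ
  set h : complexBetti X (2 * 1) := complexBetti.map κ (2 * 1) r₀ with hh
  have hhalg : h ∈ algebraicClasses X 1 := map_projectiveSpace_mem_algebraicClasses hX κ 1 r₀
  set g : V' ⟶ X := e₀ ≫ ι with hg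
  set gC : C(Motives.ComplexPoints V', Motives.ComplexPoints X) :=
    Motives.AlgPoints.mapContinuous (L := ℂ) g with hgC
  have hgC_comp : (Motives.AlgPoints.mapContinuous (L := ℂ) ι).comp
      (Motives.AlgPoints.mapContinuous (L := ℂ) e₀) = gC :=
    ContinuousMap.ext fun P ↦ (Motives.AlgPoints.map_comp_apply e₀ ι P).symm
  set η : singularCohomology ℂ ℂ (Motives.ComplexPoints V') 2 :=
    singularCohomology.map ℂ ℂ gC 2 h with hη
  -- hard Lefschetz for `η` on every fibre: `𝒱_s ↪ V' → X ↪ ℙᴹ` is a closed immersion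
  have hHL : ∀ s : Motives.ComplexPoints U', HasHardLefschetzProperty
      (singularCohomology.map ℂ ℂ
        (Motives.AlgPoints.mapContinuous (L := ℂ) (Motives.fiberι π' s)) 2 η) 2 := by
    intro s
    haveI := hemb s
    haveI : IsClosedImmersion (Motives.fiberι π' s ≫ g ≫ κ).left := by
      have e : Motives.fiberι π' s ≫ g ≫ κ = (Motives.fiberι π' s ≫ e₀ ≫ ι) ≫ κ := by
        simp only [hg, Category.assoc]
      rw [e, Over.comp_left]
      infer_instance
    have hmc : Motives.AlgPoints.mapContinuous (L := ℂ) (Motives.fiberι π' s ≫ g ≫ κ) =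
        ((Motives.AlgPoints.mapContinuous (L := ℂ) κ).comp gC).comp
          (Motives.AlgPoints.mapContinuous (L := ℂ) (Motives.fiberι π' s)) :=
      ContinuousMap.ext fun P ↦ by
        change Motives.AlgPoints.map _ P = Motives.AlgPoints.map _ (Motives.AlgPoints.map _
          (Motives.AlgPoints.map _ P))
        rw [Motives.AlgPoints.map_comp_apply, Motives.AlgPoints.map_comp_apply]
    have h' := hr₀ (hfib s) (Motives.fiberι π' s ≫ g ≫ κ)
    rw [hmc, singularCohomology.map_comp, singularCohomology.map_comp, ModuleCat.comp_apply,
      ModuleCat.comp_apply] at h'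
    exact h'
  /- (3) the generation theorem on `V'(ℂ)` -/
  have hgenV : ∀ c' : singularCohomology ℂ ℂ (Motives.ComplexPoints V') 4,
      ∃ (w : singularCohomology ℂ ℂ (Motives.ComplexPoints V') 2)
        (u : Fin N → singularCohomology ℂ ℂ (Motives.ComplexPoints V') 2),
        c' = cupProduct (show 2 + 2 = 4 by rfl) η w +
          ∑ i, cupProduct (show 2 + 2 = 4 by rfl) (ζ i) (u i) := fun c' ↦
    exists_eq_cupProduct_add_sum_of_smooth_proper_family π' η (fun i ↦ ζ i) hHL (hfib s₀) hspan c'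
  /- (4) supports of `h` and of the `ζ i` -/
  obtain ⟨Dh, hDhc, hDhcoh, hDh0⟩ := exists_isClosed_of_mem_supportedClasses hhalg
  choose D hDc hDcoh hD0 using fun i ↦ exists_isClosed_of_mem_supportedClasses (hζ i)
  /- (5) the Zariski-closed `Z ⊊ X` -/
  set C : Set W.left := ⋃ i, e₀.left.base '' D i with hC
  have hCc : IsClosed C :=
    isClosed_iUnion_of_finite fun i ↦ e₀.left.isClosedMap _ (hDc i)
  set Z : Set X.left := Dh ∪ ((Set.range ι.left.base)ᶜ ∪ ι.left.base '' C) with hZ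
  have hZc : IsClosed Z :=
    hDhc.union (isClosed_compl_range_union_image ι.left.isOpenEmbedding hCc)
  -- `W`, hence `range ι`, is non-empty: the fibre over `s₀` has a complex point
  have hWne : (Set.range ι.left.base).Nonempty := by
    haveI := irreducibleSpace_of_isSmoothProjective' (hfib s₀)
    haveI := (hfib s₀).smoothOfRelativeDimension
    haveI : Smooth (Motives.fiberOver π' s₀).hom :=
      SmoothOfRelativeDimension.smooth (n := 2) (f := (Motives.fiberOver π' s₀).hom)
    haveI : LocallyOfFiniteType (Motives.fiberOver π' s₀).hom := inferInstance
    obtain ⟨Q, -⟩ := Motives.ComplexPoints.exists_pt_mem (X := Motives.fiberOver π' s₀)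
      (Z := Set.univ) Set.univ_nonempty isClosed_univ.isLocallyClosed
    exact ⟨ι.left.base (e₀.left.base ((Motives.fiberι π' s₀).left.base Q.pt)), _, rfl⟩
  have hZcoh : ∀ z ∈ Z, ((1 : ℕ) : ℕ∞) ≤ Order.coheight z := by
    rintro z (hz | hz | hz)
    · exact hDhcoh z hz
    · rw [Nat.cast_one]
      refine one_le_coheight_of_mem_of_isClosed hX
        (isClosed_compl_iff.2 ι.left.isOpenEmbedding.isOpen_range) (fun huniv ↦ ?_) hz
      obtain ⟨x, hx⟩ := hWne
      have hx' : x ∈ (Set.range ι.left.base)ᶜ := huniv ▸ Set.mem_univ x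
      exact hx' hx
    · obtain ⟨w, hw, rfl⟩ := hz
      obtain ⟨i, hi⟩ := Set.mem_iUnion.1 hw
      obtain ⟨z', hz', rfl⟩ := hi
      rw [coheight_apply_eq_of_locallyQuasiFinite ι.left, coheight_apply_eq_of_locallyQuasiFinite
        e₀.left]
      exact hDcoh i z' hz'
  /- (6) every class dies on `(X ∖ Z)(ℂ)` -/
  refine eq_top_iff.2 fun c _ ↦ mem_supportedClasses_of_restrictCompl_eq_zero hZc hZcoh ?_
  -- `(X ∖ Z)(ℂ) ⊆ ι(ℂ)(W(ℂ))`
  have hΩ : ({P : Motives.ComplexPoints X | P.pt ∉ Z} : Set (Motives.ComplexPoints X)) ⊆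
      Set.range (Motives.AlgPoints.mapContinuous (L := ℂ) ι) := by
    intro P hP
    change P ∈ Set.range (Motives.AlgPoints.map (L := ℂ) ι)
    rw [Motives.AlgPoints.range_map_of_isOpenImmersion_holds ι]
    by_contra hP'
    exact hP (Or.inr (Or.inl hP'))
  change singularCohomology.map ℂ ℂ (⟨Subtype.val, continuous_subtype_val⟩ :
    C(↥({P : Motives.ComplexPoints X | P.pt ∉ Z} : Set (Motives.ComplexPoints X)),
      Motives.ComplexPoints X)) (2 * 2) c = 0
  refine singularCohomology_map_eq_zero_of_finiteCover_of_isOpenEmbedding he₀C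
    (Motives.AlgPoints.isOpenEmbedding_map_holds ι) hΩ ℂ (2 * 2) c ?_
  -- upstairs: `g^* c = η ∪ w + Σ ζ_i ∪ u_i` dies on `g(ℂ)⁻¹ (X ∖ Z)(ℂ)`
  rw [hgC_comp]
  set Ω' : Set (Motives.ComplexPoints V') := gC ⁻¹' {P : Motives.ComplexPoints X | P.pt ∉ Z}
    with hΩ'
  set incl : C(↥Ω', Motives.ComplexPoints V') := ⟨Subtype.val, continuous_subtype_val⟩ with hincl
  change singularCohomology.map ℂ ℂ incl (2 * 2) (singularCohomology.map ℂ ℂ gC (2 * 2) c) = 0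
  obtain ⟨w, u, hcw⟩ := hgenV (singularCohomology.map ℂ ℂ gC (2 * 2) c)
  -- `η` dies on `Ω'`: `g(Ω') ⊆ (X ∖ Dh)(ℂ)`
  have hη0 : singularCohomology.map ℂ ℂ incl 2 η = 0 := by
    set θ : C(↥Ω', Motives.complexPointsCompl X Dh) :=
      ⟨fun Q ↦ ⟨gC Q.1, fun hmem ↦ Q.2 (Or.inl hmem)⟩, by fun_prop⟩ with hθ
    have hfac : gC.comp incl = (⟨Subtype.val, continuous_subtype_val⟩ :
        C(Motives.complexPointsCompl X Dh, Motives.ComplexPoints X)).comp θ := rfl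
    rw [hη, ← ModuleCat.comp_apply, ← singularCohomology.map_comp, hfac,
      singularCohomology.map_comp, ModuleCat.comp_apply]
    change singularCohomology.map ℂ ℂ θ 2 (complexBetti.restrictCompl X Dh (2 * 1) h) = 0
    rw [hDh0, map_zero]
  -- each `ζ i` dies on `Ω'`: `Ω' ⊆ (V' ∖ D i)(ℂ)`
  have hζ0 : ∀ i, singularCohomology.map ℂ ℂ incl 2 (ζ i) = 0 := by
    intro i
    have hsub : ∀ Q : ↥Ω', Q.1.pt ∉ D i := by
      intro Q hQ
      apply Q.2
      refine Or.inr (Or.inr ⟨e₀.left.base Q.1.pt, Set.mem_iUnion.2 ⟨i, Q.1.pt, hQ, rfl⟩, ?_⟩)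
      change ι.left.base (e₀.left.base Q.1.pt) = (Motives.AlgPoints.map (L := ℂ) g Q.1).pt
      rw [Motives.AlgPoints.pt_map, hg, Over.comp_left]
      rfl
    set θ : C(↥Ω', Motives.complexPointsCompl V' (D i)) :=
      ⟨fun Q ↦ ⟨Q.1, hsub Q⟩, by fun_prop⟩ with hθ
    have hfac : incl = (⟨Subtype.val, continuous_subtype_val⟩ :
        C(Motives.complexPointsCompl V' (D i), Motives.ComplexPoints V')).comp θ := rfl
    rw [hfac, singularCohomology.map_comp, ModuleCat.comp_apply]
    change singularCohomology.map ℂ ℂ θ 2 (complexBetti.restrictCompl V' (D i) (2 * 1) (ζ i)) = 0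
    rw [hD0 i, map_zero]
  change singularCohomology.map ℂ ℂ incl 4 (singularCohomology.map ℂ ℂ gC 4 c) = 0
  rw [hcw, map_add, map_sum, cupProduct_map, hη0, LinearMap.map_zero₂, zero_add]
  refine Finset.sum_eq_zero fun i _ ↦ ?_
  rw [cupProduct_map, hζ0 i, LinearMap.map_zero₂]

/-! ### The named fact from relative divisor classes after a finite étale base change -/

/-- **Arapura (2022), Cor. 1.5 on the smooth part from relative divisor classes after a finite
étale base change (no compactification, no degree).** The named fact
`Arapura2022_thm_1_2_smoothPart_pgZeroSurfaceFibration` follows from `hRD`: for every `f : X ⟶ Y`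
as in Cor. 1.5 (smooth projective fourfold over a smooth projective surface, surjective with
connected fibres, smooth fibres of geometric genus zero off a proper closed `T`), there are an open
immersion `ι : W ⟶ X`, a finite étale surjection `e₀ : V' ⟶ W`, a smooth proper `π' : V' ⟶ U'` onto
a smooth affine connected surface whose fibres are smooth projective surfaces embedded into `X` by
`e₀ ≫ ι`, and classes `ζ_1, …, ζ_N ∈ N¹H²(V'(ℂ); ℂ)` whose restrictions span `H²` of one fibre —
in the printed proof: `W = f⁻¹U`, `U' → U` the finite (étale, after shrinking `U`) base change
dominating the components `T_i` of `Hilb_{X/Y}` through divisors `Z_i ⊂ X_y` spanning `H²(X_y, ℚ)`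
(Lefschetz `(1,1)`, `p_g = 0`), `V' = X ×_Y U'`, `ζ_i = [𝒵_i]` the classes of the pulled-back
universal families ("after a finite base change, `[𝒵_1], …, [𝒵_N]` gives a basis of `R²f_*ℚ`").
Everything else — Thm. 1.2, Cor. 1.4, Lemma 1.2, Deligne's degeneration, hard Lefschetz on the
fibres, the Hodge conjecture in dimension `≤ 3`, Deligne's Cor. 8.2.8, Voisin's Cor. 2.12 and the
descent to `X` — is a theorem of the tree (`supportedClasses_eq_top_of_finiteEtale_surfaceFamily`,
`Arapura2022_thm_1_2_smoothPart_pgZeroSurfaceFibration_of_supportedClasses_eq_top` with `X' = X`).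
[cite: Arapura2022, Thm. 1.2, Cor. 1.4 and proof of Cor. 1.5 (p. 5)]
[cite: VoisinHodgeII2003, §11.2.1, proof of Prop. 11.15 (p. 303)]
[cite: DeligneHodgeIII1974, Cor. 8.2.8] [cite: Voisin2025, Cor. 2.12] -/
theorem Arapura2022_thm_1_2_smoothPart_pgZeroSurfaceFibration_of_relativeDivisorClasses
    (hRD : ∀ ⦃X Y : Motives.SchemeOver ℂ⦄ (f : X ⟶ Y),
      Motives.IsSmoothProjective 4 X → Motives.IsSmoothProjective 2 Y →
      Function.Surjective f.left.base →
      (∀ y : Y.left, _root_.IsPreconnected (f.left.base ⁻¹' {y})) →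
      (∃ T : Set Y.left, IsClosed T ∧ T ≠ Set.univ ∧
        ∀ s : Motives.AlgPoints Y ℂ, s.pt ∉ T →
          Motives.IsSmoothProjective 2 (Motives.fiberOver f s) ∧
          ∃ A : HodgeModel 2 (Motives.fiberOver f s), Module.finrank ℂ ↥(A.hodgePQ 2 2 0) = 0) →
      ∃ (W V' U' : Motives.SchemeOver ℂ) (ι : W ⟶ X) (_ : IsOpenImmersion ι.left)
        (e₀ : V' ⟶ W) (_ : IsFinite e₀.left) (_ : Etale e₀.left) (_ : AlgebraicGeometry.Surjective e₀.left)
        (π' : V' ⟶ U') (_ : IsAffine U'.left) (_ : ConnectedSpace U'.left)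
        (_ : SmoothOfRelativeDimension 2 U'.hom) (_ : Smooth π'.left) (_ : IsProper π'.left)
        (_ : ∀ s : Motives.ComplexPoints U', Motives.IsSmoothProjective 2 (Motives.fiberOver π' s))
        (_ : ∀ s : Motives.ComplexPoints U', IsClosedImmersion (Motives.fiberι π' s ≫ e₀ ≫ ι).left)
        (N : ℕ) (ζ : Fin N → complexBetti V' (2 * 1)) (_ : ∀ i, ζ i ∈ algebraicClasses V' 1)
        (s₀ : Motives.ComplexPoints U'),
        Submodule.span ℂ (Set.range fun i : Fin N => singularCohomology.map ℂ ℂ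
          (Motives.AlgPoints.mapContinuous (L := ℂ) (Motives.fiberι π' s₀)) 2 (ζ i)) = ⊤) :
    Arapura2022_thm_1_2_smoothPart_pgZeroSurfaceFibration := by
  intro X Y f hX hY hf hconn hgen
  obtain ⟨W, V', U', ι, hι, e₀, he₁, he₂, he₃, π', hU₁, hU₂, hU₃, hπ₁, hπ₂, hfib, hemb, N, ζ, hζ,
    s₀, hspan⟩ := hRD f hX hY hf hconn hgen
  haveI : IsIntegral Y.left := Motives.IsSmoothProjective.isIntegral_holds hY
  refine ⟨∅, isClosed_empty, Set.empty_ne_univ, fun c hc hpp ↦ ?_⟩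
  obtain ⟨μ₀, hμ₀⟩ := exists_orientationFamily_hasPoincareDuality
  have hN₀ : supportedClasses X (2 * 2) 1 = ⊤ :=
    supportedClasses_eq_top_of_finiteEtale_surfaceFamily hX ι e₀ π' hfib hemb ζ hζ s₀ hspan
  have halg : c ∈ algebraicClasses X 2 :=
    supportedHodgeClass_mem_algebraicClasses_of_hodgeConjectureFor_lt
      (Deligne1974_ker_restrictCompl_eq_iSup_range_complexGysin_holds_of
        Deligne1974_ker_pullback_eq_ker_pullback_resolution_holds)
      Voisin2025_hodgeClass_lift_complexGysin_holds
      Resolution.Hironaka1964_projective_holds (gysinMap_restrictCompl_eq_zero_of_field ℂ) μ₀ hμ₀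
      hX (hodgeConjectureFor_of_lt_four hodgeClasses_algebraic_of_dim_le_three_holds
        fun _ _ ↦ nonempty_hodgeModel_holds) 2 c hc hpp
      (hN₀ ▸ Submodule.mem_top)
  exact ⟨c, halg, by rw [sub_self, map_zero]⟩

/-! ### The named fact from divisor classes on the base change along an affine finite étale cover -/

/-- **Arapura (2022), Cor. 1.5 on the smooth part from divisor classes on the base-changed family
over a finite étale cover of an affine open set (the shape of the printed sentence).** The named
fact follows from `hF`: for every `f : X ⟶ Y` as in Cor. 1.5 and every proper closed `T ⊊ Y` off
which the fibres are smooth projective surfaces of geometric genus zero, there are an affine open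
`j₀ : U₀ ↪ Y` missing `T` over which `f` is smooth ("choose a nonempty Zariski open subset
`U ⊂ Y` such that `f` is smooth over `U`", p. 3), a finite étale surjection `e : U' ⟶ U₀` from an
irreducible `U'` ("after a finite base change", p. 5) and classes `ζ_1, …, ζ_N ∈ N¹H²(X_{U'}(ℂ); ℂ)`
on the base-changed family `X_{U'} = X_{U₀} ×_{U₀} U' ⟶ U'` (the classes `[𝒵_i]` of the relative
divisors, p. 5) whose restrictions span `H²` of the fibre over one `s₀ ∈ U'(ℂ)` ("`[𝒵_1], …, [𝒵_N]`
gives a basis of `R²f_*ℚ`"). Proof: the data of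
`Arapura2022_thm_1_2_smoothPart_pgZeroSurfaceFibration_of_relativeDivisorClasses` with
`W = X_{U₀}`, `ι = pr_X` (an open immersion), `V' = X_{U'}`, `e₀ = pr : X_{U'} ⟶ X_{U₀}` (finite
étale surjective), `π' = X_{U'} ⟶ U'` (smooth, proper); `U'` is affine (finite over affine),
connected, smooth of dimension `2`; the fibres of `π'` are the fibres of `f` over points off `T`
(`Motives.fiberOverFamilyPullbackIso`, twice) — smooth projective surfaces, closed subschemes of
`X`. [cite: Arapura2022, §1 p. 3 and proof of Cor. 1.5 (p. 5)]
[cite: VoisinHodgeII2003, §11.2.1, proof of Prop. 11.15 (p. 303)] -/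
theorem Arapura2022_thm_1_2_smoothPart_pgZeroSurfaceFibration_of_affineFiniteEtaleBaseChange
    (hF : ∀ ⦃X Y : Motives.SchemeOver ℂ⦄ (f : X ⟶ Y),
      Motives.IsSmoothProjective 4 X → Motives.IsSmoothProjective 2 Y →
      Function.Surjective f.left.base →
      (∀ y : Y.left, _root_.IsPreconnected (f.left.base ⁻¹' {y})) →
      ∀ (T : Set Y.left), IsClosed T → T ≠ Set.univ →
      (∀ s : Motives.AlgPoints Y ℂ, s.pt ∉ T →
          Motives.IsSmoothProjective 2 (Motives.fiberOver f s) ∧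
          ∃ A : HodgeModel 2 (Motives.fiberOver f s), Module.finrank ℂ ↥(A.hodgePQ 2 2 0) = 0) →
      ∃ (U₀ : Motives.SchemeOver ℂ) (j₀ : U₀ ⟶ Y) (_ : IsOpenImmersion j₀.left) (_ : IsAffine U₀.left)
        (_ : ∀ u : U₀.left, j₀.left.base u ∉ T)
        (_ : Smooth (Motives.familyPullback.snd f j₀).left)
        (U' : Motives.SchemeOver ℂ) (e : U' ⟶ U₀) (_ : IsFinite e.left) (_ : Etale e.left)
        (_ : AlgebraicGeometry.Surjective e.left) (_ : IrreducibleSpace U'.left)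
        (N : ℕ) (ζ : Fin N → complexBetti
          (Motives.familyPullback (Motives.familyPullback.snd f j₀) e) (2 * 1))
        (_ : ∀ i, ζ i ∈
          algebraicClasses (Motives.familyPullback (Motives.familyPullback.snd f j₀) e) 1)
        (s₀ : Motives.ComplexPoints U'),
        Submodule.span ℂ (Set.range fun i : Fin N => singularCohomology.map ℂ ℂ
          (Motives.AlgPoints.mapContinuous (L := ℂ)
            (Motives.fiberι (Motives.familyPullback.snd (Motives.familyPullback.snd f j₀) e) s₀))
          2 (ζ i)) = ⊤) :
    Arapura2022_thm_1_2_smoothPart_pgZeroSurfaceFibration := by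
  refine Arapura2022_thm_1_2_smoothPart_pgZeroSurfaceFibration_of_relativeDivisorClasses
    fun X Y f hX hY hf hconn hgen ↦ ?_
  obtain ⟨T, hTc, hTne, hfibT⟩ := hgen
  obtain ⟨U₀, j₀, hj₀, hU₀, hj₀T, hsm, U', e, he₁, he₂, he₃, hirr, N, ζ, hζ, s₀, hspan⟩ :=
    hF f hX hY hf hconn T hTc hTne hfibT
  haveI := hj₀; haveI := hU₀; haveI := hsm; haveI := he₁; haveI := he₂; haveI := he₃
  haveI := hirr
  -- notation: `π₀ : X_{U₀} ⟶ U₀`, `ι : X_{U₀} ⟶ X`, `π' : X_{U'} ⟶ U'`, `e₀ : X_{U'} ⟶ X_{U₀}`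
  haveI : IsProper X.hom := hX.isProjectiveOver.isProper
  haveI : IsProper Y.hom := hY.isProjectiveOver.isProper
  haveI : IsSeparated Y.hom := inferInstance
  haveI : IsProper f.left := by
    have h : IsProper (f.left ≫ Y.hom) := by rw [Over.w f]; infer_instance
    exact IsProper.of_comp f.left Y.hom
  haveI : IsOpenImmersion (Motives.familyPullback.fst f j₀).left := by
    change IsOpenImmersion (Limits.pullback.fst f.left j₀.left); infer_instance
  haveI : IsFinite (Motives.familyPullback.fst (Motives.familyPullback.snd f j₀) e).left := by
    change IsFinite (Limits.pullback.fst (Motives.familyPullback.snd f j₀).left e.left)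
    infer_instance
  haveI : Etale (Motives.familyPullback.fst (Motives.familyPullback.snd f j₀) e).left := by
    change Etale (Limits.pullback.fst (Motives.familyPullback.snd f j₀).left e.left)
    infer_instance
  haveI : AlgebraicGeometry.Surjective
      (Motives.familyPullback.fst (Motives.familyPullback.snd f j₀) e).left := by
    change AlgebraicGeometry.Surjective
      (Limits.pullback.fst (Motives.familyPullback.snd f j₀).left e.left)
    infer_instance
  haveI : Smooth (Motives.familyPullback.snd (Motives.familyPullback.snd f j₀) e).left := by
    change Smooth (Limits.pullback.snd (Motives.familyPullback.snd f j₀).left e.left)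
    infer_instance
  haveI : IsProper (Motives.familyPullback.snd f j₀).left := by
    change IsProper (Limits.pullback.snd f.left j₀.left); infer_instance
  haveI : IsProper (Motives.familyPullback.snd (Motives.familyPullback.snd f j₀) e).left := by
    change IsProper (Limits.pullback.snd (Motives.familyPullback.snd f j₀).left e.left)
    infer_instance
  -- the base `U'`: affine, connected, a smooth surface
  haveI : IsAffine U'.left := isAffine_of_isAffineHom e.left
  haveI : ConnectedSpace U'.left := inferInstance
  haveI := hY.smoothOfRelativeDimension
  haveI : SmoothOfRelativeDimension 2 U₀.hom := by
    rw [← Over.w j₀]; exact inferInstanceAs (SmoothOfRelativeDimension (0 + 2) (j₀.left ≫ Y.hom))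
  haveI : SmoothOfRelativeDimension 2 U'.hom := by
    rw [← Over.w e]; exact inferInstanceAs (SmoothOfRelativeDimension (0 + 2) (e.left ≫ U₀.hom))
  -- the fibres of `π'` are fibres of `f` off `T`
  have hpt : ∀ s : Motives.ComplexPoints U',
      (Motives.AlgPoints.map j₀ (Motives.AlgPoints.map e s)).pt ∉ T := fun s ↦ by
    rw [Motives.AlgPoints.pt_map]
    exact hj₀T _
  have hfib : ∀ s : Motives.ComplexPoints U', Motives.IsSmoothProjective 2
      (Motives.fiberOver (Motives.familyPullback.snd (Motives.familyPullback.snd f j₀) e) s) :=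
    fun s ↦ ((hfibT _ (hpt s)).1.of_iso (Motives.fiberOverFamilyPullbackIso f j₀ _).symm).of_iso
      (Motives.fiberOverFamilyPullbackIso (Motives.familyPullback.snd f j₀) e s).symm
  have hemb : ∀ s : Motives.ComplexPoints U', IsClosedImmersion
      (Motives.fiberι (Motives.familyPullback.snd (Motives.familyPullback.snd f j₀) e) s ≫
        Motives.familyPullback.fst (Motives.familyPullback.snd f j₀) e ≫
          Motives.familyPullback.fst f j₀).left := by
    intro s
    have h1 := Motives.fiberOverFamilyPullbackIso_hom_fiberι (Motives.familyPullback.snd f j₀) e s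
    have h2 := Motives.fiberOverFamilyPullbackIso_hom_fiberι f j₀ (Motives.AlgPoints.map e s)
    have hcomp : Motives.fiberι (Motives.familyPullback.snd (Motives.familyPullback.snd f j₀) e) s ≫
        Motives.familyPullback.fst (Motives.familyPullback.snd f j₀) e ≫
          Motives.familyPullback.fst f j₀ =
        (Motives.fiberOverFamilyPullbackIso (Motives.familyPullback.snd f j₀) e s).hom ≫
          (Motives.fiberOverFamilyPullbackIso f j₀ (Motives.AlgPoints.map e s)).hom ≫
            Motives.fiberι f (Motives.AlgPoints.map j₀ (Motives.AlgPoints.map e s)) := by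
      rw [← Category.assoc, ← h1, Category.assoc, ← h2]
    haveI : IsClosedImmersion (Motives.fiberι f
        (Motives.AlgPoints.map j₀ (Motives.AlgPoints.map e s))).left := by
      haveI : IsClosedImmersion (Motives.AlgPoints.map j₀ (Motives.AlgPoints.map e s)).left :=
        Motives.CurveNet.isClosedImmersion_left_of_isSeparated _
      rw [Motives.fiberι_left]
      exact MorphismProperty.pullback_fst (P := @IsClosedImmersion) _ _ inferInstance
    rw [hcomp, Over.comp_left, Over.comp_left]
    infer_instance
  exact ⟨Motives.familyPullback f j₀, Motives.familyPullback (Motives.familyPullback.snd f j₀) e, U',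
    Motives.familyPullback.fst f j₀, inferInstance,
    Motives.familyPullback.fst (Motives.familyPullback.snd f j₀) e,
    inferInstance, inferInstance, inferInstance,
    Motives.familyPullback.snd (Motives.familyPullback.snd f j₀) e, inferInstance, inferInstance,
    inferInstance, inferInstance, inferInstance, hfib, hemb, N, ζ, hζ, s₀, hspan⟩

end HodgeTheory

end Literature.AlgebraicGeometry.HodgeTheory

end
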